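import Summits.CriticalPhenomena.PercolationContinuityZ3.Theorems.PercNearOneGluingAdditiveGluingSetObserverSandwich
import Mathlib.Combinatorics.SetFamily.FourFunctions
import HarnessLib

/-!
# Sandwich BHK for a SET observer — III: Theorem S for an observer set

Crux `PercNearOneGluing.AdditiveGluing` (stmt-CriticalPhenomena-4576), stub `stub_goodStep` (stub-plan prover; towards
the two-relay drift theorem = `stub_blockGoodTwo` at `A.card = 3`).  The set-observer version of seat k41's Theorem S
(`SandwichK41.coreS`, `…SandwichCoreS.lean`): the observer is a SET `O`, its cluster `K_O = ⋃_{o∈O} C_o`, and the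
sandwich function is `g^(T) = 1{s ↔ O} + 1{s ↮ O} · h(K_O) · 1{O ↮ T}` (part II).  Lands `--supports` the crux;
no definitions, no named facts.

* `coreS_abs` (**Theorem S, set observer, abstract sandwich function**) and its two instances `coreS_set` (`g^(T)`)
  and `coreS_set_hat` (`ĝ^(T) = 1{O ↮ T}(1{s ↔ O} + 1{s ↮ O} h(K_O))`): for `F ≥ 0` increasing and all `X, Y ⊆ U`,
  `E[F(C_s) 1_{R_X}] · E[g^(Y) 1_{R_Y}] ≤ E[F(C_s) g^(X∩Y) 1_{R_{X∩Y}}] · P(R_{X∪Y})`.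
  BHK's induction on the vertex set verbatim (k41's proof): base case `X ∩ Y = ∅` = part II
  (`coreS_set_base`); if `Z = X ∩ Y` meets `O`, the sandwich factor is `1{s ↔ O}` on `R_Y` and the claim is BHK's
  Theorem 1.1 (`BHK2006.core`) for `G = 1{s ↔ O}`; otherwise condition on the vertices joined to `Z`
  (`step_sum`, `step_sum_gen`, `sandS_restrict`) and apply the four functions theorem with the induction hypothesis.
[cite: VandenbergHaggstromKahn2005, Thm. 1.1 (pp. 3–5)]
-/

noncomputable section

open MeasureTheory unitInterval
open Literature.Probability.LatticeModels (prodBernoulli)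
open Literature.Probability.Percolation
open Literature.Probability.Percolation.BHK2006

namespace Summit.CriticalPhenomena.PercolationContinuityZ3.Theorems

namespace SandwichSet

open scoped Classical
open DecisionTree (ind ind_of_mem ind_of_not_mem ind_nonneg)
open SandwichK41

variable {V : Type*} [Fintype V]

/-- **Theorem S for an observer SET (sandwich BHK 1.1), percolation restricted to `U`, for an ABSTRACT sandwich
function.**  `g s U T ω` is any nonnegative function, antitone in `T`, equal to `g₀ = 1{s ↔ O} + 1{s ↮ O} h(K_O)` at
`T = ∅` (`h ≤ 1`), invariant under deleting the pairs meeting `Z` in `G[U ∖ Z]`, satisfying BHK's restriction identity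
(6) for the observer set, and which on `R_T` is a fixed multiple `ε · 1{s ↔ O}` whenever `T` meets `O` (the set
sandwich function `g^(T)`: `ε = 1`; its cut version `ĝ^(T)`: `ε = 0`).  Then for `s ∈ U`, `X, Y ⊆ U` and `F ≥ 0`
increasing, `E[F(C_s) 1_{R_X}] · E[g^(Y) 1_{R_Y}] ≤ E[F(C_s) g^(X∩Y) 1_{R_{X∩Y}}] · P(R_{X∪Y})`.  BHK's induction on the
vertex set (k41's proof of Theorem S verbatim; when `Z = X ∩ Y` meets `O` the claim is `ε` times BHK's Theorem 1.1 for
`G = 1{s ↔ O}`). [cite: VandenbergHaggstromKahn2005, Thm. 1.1 (pp. 3–5)] -/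
theorem coreS_abs (w : Sym2 V → ℝ) (hw0 : ∀ e, 0 ≤ w e) (hw1 : ∀ e, w e ≤ 1)
    (hm : ∑ ω, weight w ω = 1) (O : Finset V) (h : Set (Sym2 V) → ℝ)
    (h1 : ∀ C, h C ≤ 1) (g : V → Finset V → Set V → Set (Sym2 V) → ℝ)
    (hg0 : ∀ s U T ω, 0 ≤ g s U T ω)
    (hgant : ∀ s U (T T' : Set V), T ⊆ T' → ∀ ω, g s U T' ω ≤ g s U T ω)
    (hgempty : ∀ s U ω, g s U (∅ : Set V) ω = if ∃ o ∈ O, (openGraph (ω ∩ edgesIn U)).Reachable s o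
      then (1 : ℝ) else h (⋃ o ∈ O, rC U o ω))
    (hgdiff : ∀ s (U Z : Finset V) (T : Set V) η, g s (U \ Z) T (η \ meeting Z) = g s (U \ Z) T η)
    (hgrestrict : ∀ (U Z : Finset V), Z ⊆ U → ∀ s, s ∉ Z → (∀ o ∈ O, o ∉ Z) → ∀ (W : Set V), (↑Z : Set V) ⊆ W →
      ∀ ω, (∀ n ∈ rS U Z ω, ¬ (openGraph (ω ∩ edgesIn (U \ Z))).Reachable s n) →
        g s U W ω = g s (U \ Z) ((W \ ↑Z) ∪ rS U Z ω) ω)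
    (hgmeet : ∃ ε : ℝ, 0 ≤ ε ∧ ∀ s U (T : Set V), (∃ o ∈ O, o ∈ T) → ∀ ω,
      g s U T ω * ind (rD U s T) ω =
        ε * ((if ∃ o ∈ O, (openGraph (ω ∩ edgesIn U)).Reachable s o then (1 : ℝ) else 0) * ind (rD U s T) ω))
    (U : Finset V) :
    ∀ (s : V), s ∈ U → ∀ (X Y : Set V), X ⊆ ↑U → Y ⊆ ↑U →
    ∀ (F : Set (Sym2 V) → ℝ), Monotone F → (∀ a, 0 ≤ F a) →
    (∑ ω, weight w ω * (F (rC U s ω) * ind (rD U s X) ω)) *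
      (∑ ω, weight w ω * (g s U Y ω * ind (rD U s Y) ω)) ≤
    (∑ ω, weight w ω * (F (rC U s ω) * g s U (X ∩ Y) ω * ind (rD U s (X ∩ Y)) ω)) *
      (∑ ω, weight w ω * ind (rD U s (X ∪ Y)) ω) := by
  induction U using Finset.strongInduction with
  | H U ih =>
  intro s hsU X Y hXU hYU F hF hF0
  have g0 : ∀ (U' : Finset V) (T : Set V) ω, 0 ≤ g s U' T ω := fun U' T ω => hg0 s U' T ω
  have gant : ∀ (U' : Finset V) (T T' : Set V), T ⊆ T' → ∀ ω, g s U' T' ω ≤ g s U' T ω :=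
    fun U' T T' hTT' ω => hgant s U' T T' hTT' ω
  have hRHS : 0 ≤ (∑ ω, weight w ω * (F (rC U s ω) * g s U (X ∩ Y) ω * ind (rD U s (X ∩ Y)) ω)) *
      (∑ ω, weight w ω * ind (rD U s (X ∪ Y)) ω) :=
    mul_nonneg (Finset.sum_nonneg fun ω _ => mul_nonneg (weight_nonneg hw0 hw1 ω)
      (mul_nonneg (mul_nonneg (hF0 _) (g0 _ _ _)) (ind_nonneg _ _)))
      (Finset.sum_nonneg fun ω _ => mul_nonneg (weight_nonneg hw0 hw1 ω) (ind_nonneg _ _))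
  -- trivial cases `s ∈ X`, `s ∈ Y`
  by_cases hsX : s ∈ X
  · have h0' : ∑ ω, weight w ω * (F (rC U s ω) * ind (rD U s X) ω) = 0 :=
      Finset.sum_eq_zero fun ω _ => by
        rw [rD_eq_empty hsX, ind_of_not_mem (Set.notMem_empty ω)]; ring
    rw [h0', zero_mul]; exact hRHS
  by_cases hsY : s ∈ Y
  · have h0' : ∑ ω, weight w ω * (g s U Y ω * ind (rD U s Y) ω) = 0 :=
      Finset.sum_eq_zero fun ω _ => by
        rw [rD_eq_empty hsY, ind_of_not_mem (Set.notMem_empty ω)]; ring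
    rw [h0', mul_zero]; exact hRHS
  -- `Z := X ∩ Y`
  set Z : Finset V := U.filter fun v => v ∈ X ∧ v ∈ Y with hZ
  have hZU : Z ⊆ U := Finset.filter_subset _ _
  have hmemZ : ∀ v, v ∈ Z ↔ v ∈ X ∧ v ∈ Y := fun v => by
    simp only [hZ, Finset.mem_filter, and_iff_right_iff_imp]
    exact fun h => hXU h.1
  have hsZ : s ∉ Z := fun h => hsX ((hmemZ s).1 h).1
  rcases Z.eq_empty_or_nonempty with hZe | hZne
  · -- `X ∩ Y = ∅`: part II
    have hXYe : X ∩ Y = ∅ := Set.eq_empty_of_forall_notMem fun x hx => by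
      have : x ∈ Z := (hmemZ x).2 hx
      rw [hZe] at this
      exact Finset.notMem_empty x this
    exact coreS_abs_base w hw0 hw1 hm O h h1 g hg0 hgant hgempty U s X Y hXYe F hF hF0
  · by_cases hOZ : ∃ o ∈ O, o ∈ Z
    · /- an observer point in `Z ⊆ Y`: on `R_Y` the sandwich factor is `ε · 1{s ↔ O}`, and the claim
      is `ε` times BHK's Theorem 1.1 for `G = 1{s ↔ O}`. -/
      obtain ⟨o₀, ho₀O, ho₀Z⟩ := hOZ
      have hOY : ∃ o ∈ O, o ∈ Y := ⟨o₀, ho₀O, ((hmemZ o₀).1 ho₀Z).2⟩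
      have hOXY : ∃ o ∈ O, o ∈ X ∩ Y := ⟨o₀, ho₀O, (hmemZ o₀).1 ho₀Z⟩
      obtain ⟨ε, hε0, hε⟩ := hgmeet
      set G : Set (Sym2 V) → ℝ := fun C => if ∃ o ∈ O, o = s ∨ ∃ e ∈ C, o ∈ e then 1 else 0 with hG
      have hGm : Monotone G := by
        intro C C' hCC'
        simp only [hG]
        by_cases hc : ∃ o ∈ O, o = s ∨ ∃ e ∈ C, o ∈ e
        · have hc' : ∃ o ∈ O, o = s ∨ ∃ e ∈ C', o ∈ e := by
            obtain ⟨o, ho, ho'⟩ := hc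
            exact ⟨o, ho, ho'.imp id fun ⟨e, he, hoe⟩ => ⟨e, hCC' he, hoe⟩⟩
          rw [if_pos hc, if_pos hc']
        · rw [if_neg hc]; split_ifs
          · exact zero_le_one
          · exact le_rfl
      have hG0 : ∀ C, 0 ≤ G C := fun C => by simp only [hG]; split_ifs <;> norm_num
      have hGr : ∀ ω, G (rC U s ω) = if ∃ o ∈ O, (openGraph (ω ∩ edgesIn U)).Reachable s o then 1 else 0 := by
        intro ω
        simp only [hG, rC]
        have : (∃ o ∈ O, o = s ∨ ∃ e ∈ openEdgeCluster (ω ∩ edgesIn U) s, o ∈ e) ↔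
            ∃ o ∈ O, (openGraph (ω ∩ edgesIn U)).Reachable s o :=
          exists_congr fun o => and_congr_right fun _ =>
            (reachable_iff_exists_mem_openEdgeCluster (ω ∩ edgesIn U) s o).symm
        rw [if_congr this rfl rfl]
      have hcore := core w hw0 hw1 hm U s hsU X Y hXU hYU F G hF hGm hF0 hG0
      have e2 : ∑ ω, weight w ω * (g s U Y ω * ind (rD U s Y) ω) =
          ε * ∑ ω, weight w ω * (G (rC U s ω) * ind (rD U s Y) ω) := by
        rw [Finset.mul_sum]
        exact Finset.sum_congr rfl fun ω _ => by rw [hε s U Y hOY ω, hGr]; ring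
      have e3 : ∑ ω, weight w ω * (F (rC U s ω) * g s U (X ∩ Y) ω * ind (rD U s (X ∩ Y)) ω) =
          ε * ∑ ω, weight w ω * (F (rC U s ω) * G (rC U s ω) * ind (rD U s (X ∩ Y)) ω) := by
        rw [Finset.mul_sum]
        exact Finset.sum_congr rfl fun ω _ => by rw [mul_assoc, hε s U (X ∩ Y) hOXY ω, hGr]; ring
      rw [e2, e3]
      calc (∑ ω, weight w ω * (F (rC U s ω) * ind (rD U s X) ω)) *
            (ε * ∑ ω, weight w ω * (G (rC U s ω) * ind (rD U s Y) ω))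
          = ε * ((∑ ω, weight w ω * (F (rC U s ω) * ind (rD U s X) ω)) *
              ∑ ω, weight w ω * (G (rC U s ω) * ind (rD U s Y) ω)) := by ring
        _ ≤ ε * ((∑ ω, weight w ω * (F (rC U s ω) * G (rC U s ω) * ind (rD U s (X ∩ Y)) ω)) *
              ∑ ω, weight w ω * ind (rD U s (X ∪ Y)) ω) := mul_le_mul_of_nonneg_left hcore hε0
        _ = _ := by ring
    have hOZ' : ∀ o ∈ O, o ∉ Z := fun o ho hoZ => hOZ ⟨o, ho, hoZ⟩
    /- `Z ≠ ∅`, `O ∩ Z = ∅`: condition on `S` and apply the four functions theorem with the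
    induction hypothesis on `U ∖ Z` (BHK pp. 4–5). -/
    have hss : U \ Z ⊂ U := Finset.sdiff_ssubset hZU hZne
    have hsU' : s ∈ U \ Z := Finset.mem_sdiff.2 ⟨hsU, hsZ⟩
    have hZX : (↑Z : Set V) ⊆ X := fun v hv => ((hmemZ v).1 hv).1
    have hZY : (↑Z : Set V) ⊆ Y := fun v hv => ((hmemZ v).1 hv).2
    have hZXY : (↑Z : Set V) ⊆ X ∩ Y := fun v hv => (hmemZ v).1 hv
    have hZXuY : (↑Z : Set V) ⊆ X ∪ Y := fun v hv => Or.inl (((hmemZ v).1 hv).1)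
    have e1 := step_sum hZU hsZ hZX w hm F
    have e2 : ∑ ω, weight w ω * (g s U Y ω * ind (rD U s Y) ω) =
        ∑ ω, weight w ω * ∑ η, weight w η * (g s (U \ Z) ((Y \ ↑Z) ∪ rS U Z ω) η *
          ind (rD (U \ Z) s ((Y \ ↑Z) ∪ rS U Z ω)) η) := by
      refine step_sum_gen w hm _ (fun T η => g s (U \ Z) ((Y \ ↑Z) ∪ T) η *
        ind (rD (U \ Z) s ((Y \ ↑Z) ∪ T)) η) (fun ω => ?_) (fun T η => ?_)
      · rw [hgdiff, ind_rD_diff_meeting]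
        by_cases hω : ω ∈ rD U s Y
        · have hω' : ω ∈ rD (U \ Z) s ((Y \ ↑Z) ∪ rS U Z ω) := (mem_rD_iff_restrict hZU hsZ hZY ω).1 hω
          have hS : ∀ n ∈ rS U Z ω, ¬ (openGraph (ω ∩ edgesIn (U \ Z))).Reachable s n :=
            fun n hn => hω' n (Or.inr hn)
          rw [ind_of_mem hω, ind_of_mem hω', hgrestrict U Z hZU s hsZ hOZ' Y hZY ω hS]
        · rw [ind_of_not_mem hω, ind_of_not_mem (fun h' => hω ((mem_rD_iff_restrict hZU hsZ hZY ω).2 h')),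
            mul_zero, mul_zero]
      · rw [hgdiff, ind_rD_diff_meeting]
    have e3 : ∑ ω, weight w ω * (F (rC U s ω) * g s U (X ∩ Y) ω * ind (rD U s (X ∩ Y)) ω) =
        ∑ ω, weight w ω * ∑ η, weight w η * (F (rC (U \ Z) s η) *
          g s (U \ Z) (((X ∩ Y) \ ↑Z) ∪ rS U Z ω) η *
          ind (rD (U \ Z) s (((X ∩ Y) \ ↑Z) ∪ rS U Z ω)) η) := by
      refine step_sum_gen w hm _ (fun T η => F (rC (U \ Z) s η) *
        g s (U \ Z) (((X ∩ Y) \ ↑Z) ∪ T) η * ind (rD (U \ Z) s (((X ∩ Y) \ ↑Z) ∪ T)) η)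
        (fun ω => ?_) (fun T η => ?_)
      · rw [hgdiff, ind_rD_diff_meeting, rC_diff_meeting]
        by_cases hω : ω ∈ rD U s (X ∩ Y)
        · have hω' : ω ∈ rD (U \ Z) s (((X ∩ Y) \ ↑Z) ∪ rS U Z ω) :=
            (mem_rD_iff_restrict hZU hsZ hZXY ω).1 hω
          have hS : ∀ n ∈ rS U Z ω, ¬ (openGraph (ω ∩ edgesIn (U \ Z))).Reachable s n :=
            fun n hn => hω' n (Or.inr hn)
          rw [ind_of_mem hω, ind_of_mem hω', hgrestrict U Z hZU s hsZ hOZ' (X ∩ Y) hZXY ω hS,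
            rC_restrict hsZ hS]
        · rw [ind_of_not_mem hω, ind_of_not_mem (fun h' => hω ((mem_rD_iff_restrict hZU hsZ hZXY ω).2 h')),
            mul_zero, mul_zero]
      · rw [hgdiff, ind_rD_diff_meeting, rC_diff_meeting]
    have e4 : ∑ ω, weight w ω * ind (rD U s (X ∪ Y)) ω =
        ∑ ω, weight w ω * blockE w (U \ Z) s (fun _ => 1) ((X ∪ Y) \ ↑Z) (rS U Z ω) := by
      have := step_sum hZU hsZ hZXuY w hm (fun _ => 1)
      simpa only [one_mul] using this
    rw [e1, e2, e3, e4]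
    refine four_functions_theorem_univ
      (fun ω => weight w ω * blockE w (U \ Z) s F (X \ ↑Z) (rS U Z ω))
      (fun ω => weight w ω * ∑ η, weight w η * (g s (U \ Z) ((Y \ ↑Z) ∪ rS U Z ω) η *
          ind (rD (U \ Z) s ((Y \ ↑Z) ∪ rS U Z ω)) η))
      (fun ω => weight w ω * ∑ η, weight w η * (F (rC (U \ Z) s η) *
          g s (U \ Z) (((X ∩ Y) \ ↑Z) ∪ rS U Z ω) η *
          ind (rD (U \ Z) s (((X ∩ Y) \ ↑Z) ∪ rS U Z ω)) η))
      (fun ω => weight w ω * blockE w (U \ Z) s (fun _ => 1) ((X ∪ Y) \ ↑Z) (rS U Z ω))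
      (fun ω => mul_nonneg (weight_nonneg hw0 hw1 ω) (blockE_nonneg hw0 hw1 _ _ hF0 _ _))
      (fun ω => mul_nonneg (weight_nonneg hw0 hw1 ω) (Finset.sum_nonneg fun η _ =>
        mul_nonneg (weight_nonneg hw0 hw1 η) (mul_nonneg (g0 _ _ _) (ind_nonneg _ _))))
      (fun ω => mul_nonneg (weight_nonneg hw0 hw1 ω) (Finset.sum_nonneg fun η _ =>
        mul_nonneg (weight_nonneg hw0 hw1 η)
          (mul_nonneg (mul_nonneg (hF0 _) (g0 _ _ _)) (ind_nonneg _ _))))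
      (fun ω => mul_nonneg (weight_nonneg hw0 hw1 ω)
        (blockE_nonneg hw0 hw1 _ _ (fun _ => zero_le_one) _ _))
      fun a b => ?_
    set Sa := rS U Z a with hSa
    set Sb := rS U Z b with hSb
    have hSaU : Sa ⊆ ↑(U \ Z) := rS_subset U Z a
    have hSbU : Sb ⊆ ↑(U \ Z) := rS_subset U Z b
    have hX1 : X \ ↑Z ∪ Sa ⊆ ↑(U \ Z) := Set.union_subset
      (fun v hv => by rw [Finset.coe_sdiff]; exact ⟨hXU hv.1, hv.2⟩) hSaU
    have hY1 : Y \ ↑Z ∪ Sb ⊆ ↑(U \ Z) := Set.union_subset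
      (fun v hv => by rw [Finset.coe_sdiff]; exact ⟨hYU hv.1, hv.2⟩) hSbU
    have IH := ih (U \ Z) hss s hsU' (X \ ↑Z ∪ Sa) (Y \ ↑Z ∪ Sb) hX1 hY1 F hF hF0
    have hsub3 : (X ∩ Y) \ ↑Z ∪ rS U Z (a ∩ b) ⊆ (X \ ↑Z ∪ Sa) ∩ (Y \ ↑Z ∪ Sb) := by
      refine Set.union_subset (fun v hv => ⟨Or.inl ⟨hv.1.1, hv.2⟩, Or.inl ⟨hv.1.2, hv.2⟩⟩) ?_
      exact fun v hv =>
        ⟨Or.inr (rS_inter_subset U Z a b hv).1, Or.inr (rS_inter_subset U Z a b hv).2⟩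
    have hsub4 : (X ∪ Y) \ ↑Z ∪ rS U Z (a ∪ b) ⊆ (X \ ↑Z ∪ Sa) ∪ (Y \ ↑Z ∪ Sb) := by
      rw [rS_union]
      rintro v (⟨hXY | hXY, hvZ⟩ | hS | hS)
      · exact Or.inl (Or.inl ⟨hXY, hvZ⟩)
      · exact Or.inr (Or.inl ⟨hXY, hvZ⟩)
      · exact Or.inl (Or.inr hS)
      · exact Or.inr (Or.inr hS)
    have h3 : ∑ η, weight w η * (F (rC (U \ Z) s η) * g s (U \ Z) ((X \ ↑Z ∪ Sa) ∩ (Y \ ↑Z ∪ Sb)) η *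
        ind (rD (U \ Z) s ((X \ ↑Z ∪ Sa) ∩ (Y \ ↑Z ∪ Sb))) η) ≤
        ∑ η, weight w η * (F (rC (U \ Z) s η) * g s (U \ Z) (((X ∩ Y) \ ↑Z) ∪ rS U Z (a ∩ b)) η *
          ind (rD (U \ Z) s (((X ∩ Y) \ ↑Z) ∪ rS U Z (a ∩ b))) η) :=
      Finset.sum_le_sum fun η _ => mul_le_mul_of_nonneg_left
        (mul_le_mul (mul_le_mul_of_nonneg_left (gant _ _ _ hsub3 η) (hF0 _))
          (ind_mono (rD_antitone hsub3) η) (ind_nonneg _ _) (mul_nonneg (hF0 _) (g0 _ _ _)))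
        (weight_nonneg hw0 hw1 η)
    have h4 : ∑ ω, weight w ω * ind (rD (U \ Z) s ((X \ ↑Z ∪ Sa) ∪ (Y \ ↑Z ∪ Sb))) ω ≤
        blockE w (U \ Z) s (fun _ => 1) ((X ∪ Y) \ ↑Z) (rS U Z (a ∪ b)) := by
      have := sum_ind_mono hw0 hw1 (h := fun _ => (1 : ℝ)) (fun _ => zero_le_one)
        (rD_antitone (U := U \ Z) (s := s) hsub4) (w := w)
      simp only [one_mul] at this
      simpa only [blockE, one_mul] using this
    have hn3 : 0 ≤ ∑ η, weight w η * (F (rC (U \ Z) s η) *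
        g s (U \ Z) ((X \ ↑Z ∪ Sa) ∩ (Y \ ↑Z ∪ Sb)) η *
        ind (rD (U \ Z) s ((X \ ↑Z ∪ Sa) ∩ (Y \ ↑Z ∪ Sb))) η) :=
      Finset.sum_nonneg fun η _ => mul_nonneg (weight_nonneg hw0 hw1 η)
        (mul_nonneg (mul_nonneg (hF0 _) (g0 _ _ _)) (ind_nonneg _ _))
    have hIH' : blockE w (U \ Z) s F (X \ ↑Z) Sa *
        (∑ η, weight w η * (g s (U \ Z) ((Y \ ↑Z) ∪ Sb) η * ind (rD (U \ Z) s ((Y \ ↑Z) ∪ Sb)) η)) ≤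
        (∑ η, weight w η * (F (rC (U \ Z) s η) * g s (U \ Z) (((X ∩ Y) \ ↑Z) ∪ rS U Z (a ∩ b)) η *
          ind (rD (U \ Z) s (((X ∩ Y) \ ↑Z) ∪ rS U Z (a ∩ b))) η)) *
          blockE w (U \ Z) s (fun _ => 1) ((X ∪ Y) \ ↑Z) (rS U Z (a ∪ b)) :=
      IH.trans (mul_le_mul h3 h4 (Finset.sum_nonneg fun ω _ =>
        mul_nonneg (weight_nonneg hw0 hw1 ω) (ind_nonneg _ _))
        (hn3.trans h3))
    have hwab := weight_inter_mul_union w a b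
    show weight w a * blockE w (U \ Z) s F (X \ ↑Z) Sa *
        (weight w b * ∑ η, weight w η * (g s (U \ Z) ((Y \ ↑Z) ∪ Sb) η *
          ind (rD (U \ Z) s ((Y \ ↑Z) ∪ Sb)) η)) ≤
      weight w (a ∩ b) * (∑ η, weight w η * (F (rC (U \ Z) s η) *
          g s (U \ Z) (((X ∩ Y) \ ↑Z) ∪ rS U Z (a ∩ b)) η *
          ind (rD (U \ Z) s (((X ∩ Y) \ ↑Z) ∪ rS U Z (a ∩ b))) η)) *
        (weight w (a ∪ b) * blockE w (U \ Z) s (fun _ => 1) ((X ∪ Y) \ ↑Z) (rS U Z (a ∪ b)))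
    calc weight w a * blockE w (U \ Z) s F (X \ ↑Z) Sa *
          (weight w b * ∑ η, weight w η * (g s (U \ Z) ((Y \ ↑Z) ∪ Sb) η *
            ind (rD (U \ Z) s ((Y \ ↑Z) ∪ Sb)) η))
        = (weight w a * weight w b) * (blockE w (U \ Z) s F (X \ ↑Z) Sa *
            ∑ η, weight w η * (g s (U \ Z) ((Y \ ↑Z) ∪ Sb) η *
              ind (rD (U \ Z) s ((Y \ ↑Z) ∪ Sb)) η)) := by ring
      _ ≤ (weight w (a ∩ b) * weight w (a ∪ b)) *
          ((∑ η, weight w η * (F (rC (U \ Z) s η) *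
              g s (U \ Z) (((X ∩ Y) \ ↑Z) ∪ rS U Z (a ∩ b)) η *
              ind (rD (U \ Z) s (((X ∩ Y) \ ↑Z) ∪ rS U Z (a ∩ b))) η)) *
            blockE w (U \ Z) s (fun _ => 1) ((X ∪ Y) \ ↑Z) (rS U Z (a ∪ b))) := by
          rw [hwab]
          exact mul_le_mul_of_nonneg_left hIH'
            (mul_nonneg (weight_nonneg hw0 hw1 _) (weight_nonneg hw0 hw1 _))
      _ = _ := by ring

/-- **Theorem S for an observer set** — the instance `g^(T) = 1{s ↔ O} + 1{s ↮ O} h(K_O) 1{O ↮ T}` of `coreS_abs`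
(`ε = 1`: on `R_T` with `T ∩ O ≠ ∅` the factor `1{O ↮ T}` vanishes). For `h : · → [0,1]`.
[cite: VandenbergHaggstromKahn2005, Thm. 1.1 (pp. 3–5)] -/
theorem coreS_set (w : Sym2 V → ℝ) (hw0 : ∀ e, 0 ≤ w e) (hw1 : ∀ e, w e ≤ 1)
    (hm : ∑ ω, weight w ω = 1) (O : Finset V) (h : Set (Sym2 V) → ℝ) (h0 : ∀ C, 0 ≤ h C)
    (h1 : ∀ C, h C ≤ 1) (g : V → Finset V → Set V → Set (Sym2 V) → ℝ)
    (hg : ∀ s U T ω, g s U T ω = if ∃ o ∈ O, (openGraph (ω ∩ edgesIn U)).Reachable s o then (1 : ℝ)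
      else h (⋃ o ∈ O, rC U o ω) * ind (⋂ o ∈ O, rD U o T) ω)
    (U : Finset V) :
    ∀ (s : V), s ∈ U → ∀ (X Y : Set V), X ⊆ ↑U → Y ⊆ ↑U →
    ∀ (F : Set (Sym2 V) → ℝ), Monotone F → (∀ a, 0 ≤ F a) →
    (∑ ω, weight w ω * (F (rC U s ω) * ind (rD U s X) ω)) *
      (∑ ω, weight w ω * (g s U Y ω * ind (rD U s Y) ω)) ≤
    (∑ ω, weight w ω * (F (rC U s ω) * g s U (X ∩ Y) ω * ind (rD U s (X ∩ Y)) ω)) *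
      (∑ ω, weight w ω * ind (rD U s (X ∪ Y)) ω) := by
  refine coreS_abs w hw0 hw1 hm O h h1 g (fun s U T ω => by rw [hg]; exact sandS_nonneg U s O h0 T ω)
    (fun s U T T' hTT' ω => by rw [hg, hg]; exact sandS_antitone U s O h0 hTT' ω)
    (fun s U ω => by rw [hg]; exact sandS_empty U s O h ω)
    (fun s U Z T η => by rw [hg, hg]; exact sandS_diff_meeting U Z s O h T η)
    (fun U Z hZU s hs hO W hZW ω hS => by rw [hg, hg]; exact sandS_restrict hZU hs hO h hZW hS)
    ⟨1, zero_le_one, fun s U T hT ω => ?_⟩ U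
  obtain ⟨o₀, ho₀O, ho₀T⟩ := hT
  rw [hg, one_mul]
  by_cases hω : ω ∈ rD U s T
  · by_cases hr : ∃ o ∈ O, (openGraph (ω ∩ edgesIn U)).Reachable s o
    · rw [if_pos hr, if_pos hr]
    · rw [if_neg hr, if_neg hr]
      have hno : ω ∉ ⋂ o ∈ O, rD U o T := fun h' =>
        (Set.mem_iInter₂.1 h' o₀ ho₀O) o₀ ho₀T (SimpleGraph.Reachable.refl o₀)
      rw [ind_of_not_mem hno, mul_zero]
  · rw [ind_of_not_mem hω, mul_zero, mul_zero]

/-- **Theorem S for an observer set, cut sandwich function** — the instance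
`ĝ^(T) = 1{O ↮ T} · (1{s ↔ O} + 1{s ↮ O} h(K_O))` of `coreS_abs` (`ε = 0`). For `h : · → [0,1]`.
[cite: VandenbergHaggstromKahn2005, Thm. 1.1 (pp. 3–5)] -/
theorem coreS_set_hat (w : Sym2 V → ℝ) (hw0 : ∀ e, 0 ≤ w e) (hw1 : ∀ e, w e ≤ 1)
    (hm : ∑ ω, weight w ω = 1) (O : Finset V) (h : Set (Sym2 V) → ℝ) (h0 : ∀ C, 0 ≤ h C)
    (h1 : ∀ C, h C ≤ 1) (g : V → Finset V → Set V → Set (Sym2 V) → ℝ)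
    (hg : ∀ s U T ω, g s U T ω = ind (⋂ o ∈ O, rD U o T) ω *
      (if ∃ o ∈ O, (openGraph (ω ∩ edgesIn U)).Reachable s o then (1 : ℝ) else h (⋃ o ∈ O, rC U o ω)))
    (U : Finset V) :
    ∀ (s : V), s ∈ U → ∀ (X Y : Set V), X ⊆ ↑U → Y ⊆ ↑U →
    ∀ (F : Set (Sym2 V) → ℝ), Monotone F → (∀ a, 0 ≤ F a) →
    (∑ ω, weight w ω * (F (rC U s ω) * ind (rD U s X) ω)) *
      (∑ ω, weight w ω * (g s U Y ω * ind (rD U s Y) ω)) ≤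
    (∑ ω, weight w ω * (F (rC U s ω) * g s U (X ∩ Y) ω * ind (rD U s (X ∩ Y)) ω)) *
      (∑ ω, weight w ω * ind (rD U s (X ∪ Y)) ω) := by
  refine coreS_abs w hw0 hw1 hm O h h1 g (fun s U T ω => by rw [hg]; exact sandH_nonneg U s O h0 T ω)
    (fun s U T T' hTT' ω => by rw [hg, hg]; exact sandH_antitone U s O h0 hTT' ω)
    (fun s U ω => by rw [hg]; exact sandH_empty U s O h ω)
    (fun s U Z T η => by rw [hg, hg]; exact sandH_diff_meeting U Z s O h T η)
    (fun U Z hZU s hs hO W hZW ω hS => by rw [hg, hg]; exact sandH_restrict hZU hs hO h hZW hS)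
    ⟨0, le_rfl, fun s U T hT ω => ?_⟩ U
  obtain ⟨o₀, ho₀O, ho₀T⟩ := hT
  have hno : ω ∉ ⋂ o ∈ O, rD U o T := fun h' =>
    (Set.mem_iInter₂.1 h' o₀ ho₀O) o₀ ho₀T (SimpleGraph.Reachable.refl o₀)
  rw [hg, ind_of_not_mem hno, zero_mul, zero_mul, zero_mul]

end SandwichSet

open scoped Classical in
open SandwichSet DecisionTree in
/-- **Registered stub `stub_coreSSet_sp`** (= `SandwichSet.coreS_set` on `Fin n`): Theorem S — the sandwich form of
BHK 2006 Thm 1.1 — for an observer SET. [cite: VandenbergHaggstromKahn2005, Thm. 1.1 (pp. 3–5)] -/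
theorem stub_coreSSet_sp : ∀ (n : ℕ) (w : Sym2 (Fin n) → ℝ), (∀ e, 0 ≤ w e) → (∀ e, w e ≤ 1) → ∑ ω, BHK2006.weight w ω = 1 → ∀ (O : Finset (Fin n)) (h : Set (Sym2 (Fin n)) → ℝ), (∀ C, 0 ≤ h C) → (∀ C, h C ≤ 1) → ∀ (g : Fin n → Finset (Fin n) → Set (Fin n) → Set (Sym2 (Fin n)) → ℝ), (∀ s U T ω, g s U T ω = if ∃ o ∈ O, (openGraph (ω ∩ BHK2006.edgesIn U)).Reachable s o then (1 : ℝ) else h (⋃ o ∈ O, BHK2006.rC U o ω) * DecisionTree.ind (⋂ o ∈ O, BHK2006.rD U o T) ω) → ∀ (U : Finset (Fin n)) (s : Fin n), s ∈ U → ∀ (X Y : Set (Fin n)), X ⊆ ↑U → Y ⊆ ↑U → ∀ (F : Set (Sym2 (Fin n)) → ℝ), Monotone F → (∀ a, 0 ≤ F a) → (∑ ω, BHK2006.weight w ω * (F (BHK2006.rC U s ω) * DecisionTree.ind (BHK2006.rD U s X) ω)) * (∑ ω, BHK2006.weight w ω * (g s U Y ω * DecisionTree.ind (BHK2006.rD U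 s Y) ω)) ≤ (∑ ω, BHK2006.weight w ω * (F (BHK2006.rC U s ω) * g s U (X ∩ Y) ω * DecisionTree.ind (BHK2006.rD U s (X ∩ Y)) ω)) * (∑ ω, BHK2006.weight w ω * DecisionTree.ind (BHK2006.rD U s (X ∪ Y)) ω) :=
  fun _ w hw0 hw1 hm O h h0 h1 g hg U s hsU X Y hXU hYU F hF hF0 => by
    convert coreS_set w hw0 hw1 hm O h h0 h1 g (fun s U T ω => by convert hg s U T ω using 3) U s hsU X Y
      hXU hYU F hF hF0 using 4

end Summit.CriticalPhenomena.PercolationContinuityZ3.Theorems
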